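import Mathlib.LinearAlgebra.Projection
import Literature.NumberTheory.Automorphic.LocalConstants
import Literature.NumberTheory.Automorphic.LParameter
import Literature.NumberTheory.GaloisRepresentations.WeilDeligneRepProofs
import HarnessLib

/-!
# Gluing isomorphisms of sub-Weil–Deligne representations over an internal direct sum

Helper file (stub G5 `stub_isEquivalent_ofSubrep_sup`, a registered sub-goal toward stub S-17a-B
`stub_isEquivalent_of_finrank_invariants_tprod_eq`) of line `Sketch` for the crux
`IrreducibilityBySelfDuality.ReciprocityUpToIrreducibilityR` (item stmt-Langlands-17925).  The lead proves
Henniart 2002, Thm 1.7 (a) (Galois side) by matching the string summands of two Frobenius-semisimple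
Weil–Deligne representations `σ, σ'` one at a time; this file supplies the gluing step: if
`U = A ⊕ B` is an internal direct sum of sub-Weil–Deligne representations of `σ` (`A ⊔ B`, `Disjoint A B`),
`U' = A' ⊕ B'` likewise for `σ'`, and `σ|_A ≅ σ'|_{A'}`, `σ|_B ≅ σ'|_{B'}`, then `σ|_U ≅ σ'|_{U'}`
(`stub_isEquivalent_ofSubrep_sup`).  Also: `σ|_⊤ ≅ σ` (`isEquivalent_ofSubrep_top`) and invariance of
`σ.ofSubrep p` under `p = q` (`isEquivalent_ofSubrep_of_eq`, `isEquivalent_ofSubrep_of_eq_top`).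
Symmetry / transitivity of `WeilDeligneRep.IsEquivalent` are the tree's
`WeilDeligneRep.IsEquivalent.symm` / `.trans` (`Literature.NumberTheory.Automorphic.LParameter`, imported here).

Proof of the gluing: `(a, b) ↦ a + b` is a linear isomorphism `↥A × ↥B ≃ₗ ↥(A ⊔ B)` when `Disjoint A B`
(injective by disjointness, surjective by `Submodule.mem_sup`); transporting `e_A × e_B` along these
isomorphisms gives `Φ : ↥(A ⊔ B) ≃ₗ ↥(A' ⊔ B')` with `Φ (a + b) = e_A a + e_B b`, which intertwines `ρ` and
`N` because `ρ(w)` and `N` act on `a + b` summand-wise and `e_A`, `e_B` intertwine.  Pure linear algebra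
over the tree's `WeilDeligneRep` / `WeilDeligneRep.ofSubrep`; no definitions; standard axioms only.

Sources: P. Deligne, *Les constantes des équations fonctionnelles des fonctions L* (Antwerp II, LNM 349,
1973), §8.4.1 (the additive category of Weil–Deligne representations); G. Henniart, *Une caractérisation
de la correspondance de Langlands locale pour `GL(n)`*, Bull. Soc. Math. France 130 (2002), Thm 1.7 (a).
-/

noncomputable section

-- lint debt (justified): the route namespace `Summit.Langlands.Langlands.…` (summit = problem = `Langlands`)
-- repeats a component by design (D-0022), so `linter.dupNamespace` would flag every declaration.
set_option linter.dupNamespace false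

open Module
open Literature.NumberTheory.Automorphic Literature.NumberTheory.GaloisRepresentations
open Literature.NumberTheory.GaloisRepresentations.WeilGroup
open Literature.NumberTheory.GaloisRepresentations.IsNonarchimedeanLocalField

namespace Summit.Langlands.Langlands.Theorems.ReciprocityUpToIrreducibilityR

/-! ## Linear algebra: `↥A × ↥B ≃ₗ ↥(A ⊔ B)` for disjoint submodules -/

/-- For disjoint submodules `A, B` of a module `M`, the sum map `(a, b) ↦ a + b` is a linear
isomorphism `↥A × ↥B ≃ₗ ↥(A ⊔ B)` (injective by `Disjoint A B`, surjective by `Submodule.mem_sup`);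
stated as an existence so that no definition is introduced. [folklore] -/
theorem exists_prodEquiv_sup {R : Type*} [Ring R] {M : Type*} [AddCommGroup M] [Module R M]
    {A B : Submodule R M} (h : Disjoint A B) :
    ∃ s : (↥A × ↥B) ≃ₗ[R] ↥(A ⊔ B), ∀ (a : A) (b : B), (s (a, b) : M) = a + b := by
  refine ⟨LinearEquiv.ofBijective
    ((Submodule.inclusion (le_sup_left : A ≤ A ⊔ B)).coprod
      (Submodule.inclusion (le_sup_right : B ≤ A ⊔ B))) ⟨?_, ?_⟩, fun a b => rfl⟩
  · rw [injective_iff_map_eq_zero]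
    rintro ⟨a, b⟩ hab
    have hab' : (a : M) + b = 0 := congr_arg Subtype.val hab
    have ha : (a : M) ∈ B := by
      rw [eq_neg_of_add_eq_zero_left hab']
      exact B.neg_mem b.2
    have ha0 : (a : M) = 0 := Submodule.disjoint_def.mp h a a.2 ha
    have hb0 : (b : M) = 0 := by rwa [ha0, zero_add] at hab'
    exact Prod.ext (Subtype.ext ha0) (Subtype.ext hb0)
  · rintro ⟨x, hx⟩
    obtain ⟨a, ha, b, hb, rfl⟩ := Submodule.mem_sup.mp hx
    exact ⟨(⟨a, ha⟩, ⟨b, hb⟩), rfl⟩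

/-! ## Sub-Weil–Deligne representations and isomorphisms -/

variable {F : Type} [Field F] [ValuativeRel F] [TopologicalSpace F] [IsNonarchimedeanLocalField F]
variable {V : Type*} [AddCommGroup V] [Module ℂ V] {V' : Type*} [AddCommGroup V'] [Module ℂ V']

/-- An isomorphism of Weil–Deligne representations intertwines the Weil group actions (pointwise form).
Ref: Deligne, Antwerp II (1973), §8.4.1. [cite: II1973, §8.4.1] -/
theorem equiv_apply_ρ {r : WeilDeligneRep F ℂ V} {r' : WeilDeligneRep F ℂ V'} (e : r.Equiv r')
    (w : WeilGroup F) (v : V) : e.toLinearEquiv (r.ρ w v) = r'.ρ w (e.toLinearEquiv v) :=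
  e.toIntertwiningMap.isIntertwining _ _ w v

/-- An isomorphism of Weil–Deligne representations intertwines the monodromy operators (pointwise form).
Ref: Deligne, Antwerp II (1973), §8.4.1. [cite: II1973, §8.4.1] -/
theorem equiv_apply_N {r : WeilDeligneRep F ℂ V} {r' : WeilDeligneRep F ℂ V'} (e : r.Equiv r')
    (v : V) : e.toLinearEquiv (r.N v) = r'.N (e.toLinearEquiv v) :=
  LinearMap.congr_fun e.comm_N v

/-- On an internal direct sum `A ⊕ B ≅ A ⊔ B` of sub-Weil–Deligne representations, `ρ(w)` acts
summand-wise: `ρ|_{A ⊔ B}(w) (a + b) = ρ|_A(w) a + ρ|_B(w) b`.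
Ref: Deligne, Antwerp II (1973), §8.4.1. [cite: II1973, §8.4.1] -/
theorem ofSubrep_ρ_prodEquiv (σ : WeilDeligneRep F ℂ V) {A B : Submodule ℂ V} (hA : σ.IsSubrep A)
    (hB : σ.IsSubrep B) (hAB : σ.IsSubrep (A ⊔ B)) (s : (↥A × ↥B) ≃ₗ[ℂ] ↥(A ⊔ B))
    (hs : ∀ (a : A) (b : B), (s (a, b) : V) = a + b) (w : WeilGroup F) (a : A) (b : B) :
    (σ.ofSubrep (A ⊔ B) hAB).ρ w (s (a, b)) =
      s ((σ.ofSubrep A hA).ρ w a, (σ.ofSubrep B hB).ρ w b) := by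
  apply Subtype.ext
  rw [hs]
  change σ.ρ w (s (a, b) : V) = σ.ρ w a + σ.ρ w b
  rw [hs, map_add]

/-- On an internal direct sum `A ⊕ B ≅ A ⊔ B` of sub-Weil–Deligne representations, `N` acts
summand-wise: `N|_{A ⊔ B} (a + b) = N|_A a + N|_B b`.
Ref: Deligne, Antwerp II (1973), §8.4.1. [cite: II1973, §8.4.1] -/
theorem ofSubrep_N_prodEquiv (σ : WeilDeligneRep F ℂ V) {A B : Submodule ℂ V} (hA : σ.IsSubrep A)
    (hB : σ.IsSubrep B) (hAB : σ.IsSubrep (A ⊔ B)) (s : (↥A × ↥B) ≃ₗ[ℂ] ↥(A ⊔ B))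
    (hs : ∀ (a : A) (b : B), (s (a, b) : V) = a + b) (a : A) (b : B) :
    (σ.ofSubrep (A ⊔ B) hAB).N (s (a, b)) = s ((σ.ofSubrep A hA).N a, (σ.ofSubrep B hB).N b) := by
  apply Subtype.ext
  rw [hs]
  change σ.N (s (a, b) : V) = σ.N a + σ.N b
  rw [hs, map_add]

/-- **`σ|_⊤ ≅ σ`**: the sub-Weil–Deligne representation on the top submodule is isomorphic to `σ`
(via `Submodule.topEquiv`).  Ref: Deligne, Antwerp II (1973), §8.4.1. [cite: II1973, §8.4.1] -/
theorem isEquivalent_ofSubrep_top (σ : WeilDeligneRep F ℂ V) (h : σ.IsSubrep ⊤) :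
    (σ.ofSubrep ⊤ h).IsEquivalent σ :=
  ⟨⟨Representation.Equiv.mk Submodule.topEquiv fun _ => LinearMap.ext fun _ => rfl,
    LinearMap.ext fun _ => rfl⟩⟩

/-- `σ.ofSubrep p hp ≅ σ.ofSubrep q hq` whenever `p = q` (the restriction only depends on the
submodule).  Ref: Deligne, Antwerp II (1973), §8.4.1. [cite: II1973, §8.4.1] -/
theorem isEquivalent_ofSubrep_of_eq (σ : WeilDeligneRep F ℂ V) {p q : Submodule ℂ V}
    (hp : σ.IsSubrep p) (hq : σ.IsSubrep q) (h : p = q) :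
    (σ.ofSubrep p hp).IsEquivalent (σ.ofSubrep q hq) := by
  subst h
  exact ⟨WeilDeligneRep.Equiv.refl _⟩

/-- **`σ|_p ≅ σ` when `p = ⊤`.**  Ref: Deligne, Antwerp II (1973), §8.4.1. [cite: II1973, §8.4.1] -/
theorem isEquivalent_ofSubrep_of_eq_top (σ : WeilDeligneRep F ℂ V) {p : Submodule ℂ V}
    (hp : σ.IsSubrep p) (h : p = ⊤) : (σ.ofSubrep p hp).IsEquivalent σ := by
  subst h
  exact isEquivalent_ofSubrep_top σ hp

/-! ## The registered stub G5 -/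

/-- **Stub G5 (gluing isomorphisms over an internal direct sum).**  Let `σ, σ'` be Weil–Deligne
representations on finite-dimensional complex spaces `V, V'`, let `A, B ≤ V` and `A', B' ≤ V'` be
sub-Weil–Deligne representations with `A ⊔ B`, `A' ⊔ B'` again sub-representations (automatic, kept as
data to match the caller) and `A ∩ B = 0`, `A' ∩ B' = 0`.  If `σ|_A ≅ σ'|_{A'}` and `σ|_B ≅ σ'|_{B'}` then
`σ|_{A ⊔ B} ≅ σ'|_{A' ⊔ B'}`: the isomorphism is `a + b ↦ e_A a + e_B b`, well defined and bijective because
both sums are direct, and it intertwines `ρ` and `N` summand-wise.  (Morphisms of Weil–Deligne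
representations form an additive category: Deligne, Antwerp II (1973), §8.4.1; used in Henniart 2002,
§4, proof of Thm 1.7 (a).) [cite: II1973, §8.4.1] -/
theorem stub_isEquivalent_ofSubrep_sup : ∀ (F : Type) [Field F] [ValuativeRel F] [TopologicalSpace F] [IsNonarchimedeanLocalField F] (V : Type) [AddCommGroup V] [Module ℂ V] [FiniteDimensional ℂ V] (V' : Type) [AddCommGroup V'] [Module ℂ V'] [FiniteDimensional ℂ V'] (σ : WeilDeligneRep F ℂ V) (σ' : WeilDeligneRep F ℂ V') (A B : Submodule ℂ V) (A' B' : Submodule ℂ V') (hA : σ.IsSubrep A) (hB : σ.IsSubrep B) (hA' : σ'.IsSubrep A') (hB' : σ'.IsSubrep B') (hAB : σ.IsSubrep (A ⊔ B)) (hAB' : σ'.IsSubrep (A' ⊔ B')), Disjoint A B → Disjoint A' B' → (σ.ofSubrep A hA).IsEquivalent (σ'.ofSubrep A' hA') → (σ.ofSubrep B hB).IsEquivalent (σ'.ofSubrep B' hB') → (σ.ofSubrep (A ⊔ B) hAB).IsEquivalent (σ'.ofSubrep (A' ⊔ B') hAB') := by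
  intro F _ _ _ _ V _ _ _ V' _ _ _ σ σ' A B A' B' hA hB hA' hB' hAB hAB' hd hd' hisoA hisoB
  obtain ⟨eA⟩ := hisoA
  obtain ⟨eB⟩ := hisoB
  obtain ⟨s, hs⟩ := exists_prodEquiv_sup hd
  obtain ⟨s', hs'⟩ := exists_prodEquiv_sup hd'
  let Φ : ↥(A ⊔ B) ≃ₗ[ℂ] ↥(A' ⊔ B') :=
    s.symm ≪≫ₗ (eA.toLinearEquiv.prodCongr eB.toLinearEquiv) ≪≫ₗ s'
  have hΦ : ∀ (a : A) (b : B), Φ (s (a, b)) = s' (eA.toLinearEquiv a, eB.toLinearEquiv b) := by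
    intro a b
    simp only [Φ, LinearEquiv.trans_apply, LinearEquiv.symm_apply_apply, LinearEquiv.prodCongr_apply]
  refine ⟨⟨Representation.Equiv.mk Φ fun w => ?_, ?_⟩⟩
  · refine LinearMap.ext fun x => ?_
    obtain ⟨⟨a, b⟩, rfl⟩ := s.surjective x
    simp only [LinearMap.coe_comp, Function.comp_apply, LinearEquiv.coe_coe]
    rw [ofSubrep_ρ_prodEquiv σ hA hB hAB s hs, hΦ, hΦ, ofSubrep_ρ_prodEquiv σ' hA' hB' hAB' s' hs',
      equiv_apply_ρ, equiv_apply_ρ]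
  · change (Φ : ↥(A ⊔ B) →ₗ[ℂ] ↥(A' ⊔ B')) ∘ₗ (σ.ofSubrep (A ⊔ B) hAB).N =
      (σ'.ofSubrep (A' ⊔ B') hAB').N ∘ₗ (Φ : ↥(A ⊔ B) →ₗ[ℂ] ↥(A' ⊔ B'))
    refine LinearMap.ext fun x => ?_
    obtain ⟨⟨a, b⟩, rfl⟩ := s.surjective x
    simp only [LinearMap.coe_comp, Function.comp_apply, LinearEquiv.coe_coe]
    rw [ofSubrep_N_prodEquiv σ hA hB hAB s hs, hΦ, hΦ, ofSubrep_N_prodEquiv σ' hA' hB' hAB' s' hs',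
      equiv_apply_N, equiv_apply_N]

end Summit.Langlands.Langlands.Theorems.ReciprocityUpToIrreducibilityR
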